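import Literature.Computability.QuantumComplexity.F2PolynomialFourierTails
import Literature.Computability.Complexity.XorFiberGrowth
import HarnessLib

/-!
# Proof of CHHL Theorem 6.1: `L₁` Fourier tails of low-degree `𝔽₂`-polynomials

Discharge of the named fact `Literature.Computability.QuantumComplexity.CHHL2018_fourierL1Level_le`
(file `F2PolynomialFourierTails`; the sibling `F2PolynomialFourierTailsProofs` holds the level-one
bound of CHLT): for `p ∈ 𝔽₂[x₁,…,xₘ]` of total degree `≤ d`, `f = (-1)^p` and
every `k`, `∑_{|S|=k} |f̂(S)| ≤ (k · 2^{3d})^k` — E. Chattopadhyay, P. Hatami, K. Hosseini,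
S. Lovett, *Pseudorandom generators from polarizing random walks*, Theory of Computing 15 (2019),
art. 10, §6, Theorem 6.1 (pp. 18–20) [ChattopadhyayEtAl2019]. The printed proof is followed:

* **Lemma 6.2** `W(d,k)² ≤ 2^{2k} W(d-1,2k) + W(d,k) ∑_{ℓ=1}^{k} (k choose ℓ) W(d,k-ℓ)`, obtained by
  splitting `W_k(f)² = ∑_{S,T} |f̂(S)||f̂(T)|` according to `ℓ = |S ∩ T|` (`zlevel_sq_eq`) and
  bounding the parts by
  - **Claim 6.3** (`claim63`): `∑_{B ⊇ A, |B| = b} |f̂(B)| ≤ W(d, b-a)` — induction on `|A|`,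
    restricting one variable (`zcoef_insert`: `f̂(B ∪ {i}) = (f̂_{i←0}(B) − f̂_{i←1}(B))/2`);
  - **Claim 6.4** (`claim64`): the disjoint pairs, through the identity
    `f̂(S) f̂(T) = 2^{-2n} ∑_{y,z} χ_S(y) χ_T(z) ĥ_{y,z}(S ∪ T)` with `h_{y,z}(x) = f(x⊕y) f(x⊕z)`
    the (translated) derivative of `f` (`zcoef_mul_zcoef`), and the count
    `#{(S,T) : S ⊔ T = R} ≤ (2k choose k)` (`sum_disjoint_pairs_le`);
  - **Claim 6.5** (`claim65`): pairs meeting in `ℓ ≥ 1` points, by Claim 6.3 and double counting;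
* **Theorem 6.1 from Lemma 6.2** (`zlevel_le_bound`): induction on `d`, inside strong induction
  on `k`, closing with the elementary inequality `W² ≤ A + W B`, `A/M + B ≤ M ⇒ W ≤ M`
  (`le_of_sq_le`) and the arithmetic of p. 18–19 (`choose_mul_bound_div_le`,
  `sum_choose_mul_bound_le` = binomial theorem, `numeric_ineq` = the cases `k = 1`, `k > 1`).

Design choices. (1) The degree hypothesis is carried through the induction not as "`f = (-1)^p`,
`deg p ≤ d`" but as membership of `G : {0,1}ⁿ → 𝔽₂` in `CHHL2018.lowDeg n d` = "all `(d+1)`-fold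
mixed discrete derivatives vanish" (recursive in `d`); this class contains the evaluations of
polynomials of total degree `≤ d` (`eval_mem_lowDeg`, by the monomial expansion: multiplying by a
coordinate raises the degree by at most one, `coordMul_mem_lowDeg`) and is visibly closed under the
three operations the proof uses — restrictions `xᵢ ← c` (Claim 6.3), translations and derivatives
(Claim 6.4, "taking derivatives always reduces the degree"). The maximum `W(d,k)` over the class is
never formed: Claims 6.3/6.5 are proved for an arbitrary member given a bound valid over the whole
class, which is what the induction supplies. (2) The paper starts the induction at `d = 1`
("straightforward"); we start at `d = 0` (constant functions have no mass at positive levels,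
`zlevel_eq_zero_of_const`), and Lemma 6.2 then also yields the case `d = 1` since `W(0,2k) = 0`.
(3) Level `k = 0` (`W_0 ≤ 1`) is included so that `W(d, k-ℓ)` with `ℓ = k` needs no side
condition; the fact itself only asks `k ≥ 1`. (4) Claim 6.4 is kept with the exact factor
`(2k choose k)`, bounded by `2^{2k}` (`Nat.choose_le_two_pow`) only in the final arithmetic.

Fourier conventions are those of the fact: `boolFourierCoeff`/`fourierL1Level` of file
`RazTalForrelation` (normalised `{±1}` coefficients, characters `walsh`, signs `sgn`), bridged by
`rfl` to the `𝔽₂`-valued versions `zcoef`/`zlevel` used here (`fourierL1Level_eq_zlevel`);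
orthogonality of characters comes from `Complexity/BooleanFourier`, xor-translations `xorVec` (with
`walsh_xorVec`, `sum_comp_xorVec`) from `Complexity/XorFiberGrowth`.

NOT here: the PRG consequences (CHHL §6 remark, CHLT), the level-one bound `L_{1,1} ≤ 4d` of CHLT
(fact `CHLT2019_fourierL1LevelOne_le`, a different argument), sharper level-two bounds.

## References

* E. Chattopadhyay, P. Hatami, K. Hosseini, S. Lovett, *Pseudorandom generators from polarizing
  random walks*, Theory of Computing 15 (2019), art. 10, §6 (Thm 6.1, Lemma 6.2, Claims 6.3–6.5,
  pp. 18–20); CCC 2018 version §6 p. 1:19 [ChattopadhyayEtAl2019].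
* R. O'Donnell, *Analysis of Boolean Functions*, CUP 2014, §1.2–1.4 (coefficients, characters,
  orthogonality) [ODonnell2014].
-/

noncomputable section

namespace Literature.Computability.QuantumComplexity

open Finset Literature.Probability.RandomGraphs.LowDegree Literature.Computability.Complexity
open Literature.Computability.Complexity.LowDegree (xorVec xorVec_apply xorVec_xorVec_cancel
  walsh_xorVec sum_comp_xorVec)

namespace CHHL2018

variable {n : ℕ}

/-! ### The cube: xor-translations and Walsh characters -/

/-- `(x ⊕ a) ⊕ b = (x ⊕ b) ⊕ a`. [folklore] -/
theorem xorVec_right_comm (x a b : Fin n → Bool) : xorVec (xorVec x a) b = xorVec (xorVec x b) a := by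
  funext i; simp only [xorVec_apply]; cases x i <;> cases a i <;> cases b i <;> rfl

/-- `(x ⊕ y) ⊕ (y ⊕ z) = x ⊕ z`. [folklore] -/
theorem xorVec_xorVec_xorVec (x y z : Fin n → Bool) : xorVec (xorVec x y) (xorVec y z) = xorVec x z := by
  funext i; simp only [xorVec_apply]; cases x i <;> cases y i <;> cases z i <;> rfl

/-- `χ_{S ∪ T} = χ_S χ_T` for disjoint `S, T`. [folklore] -/
theorem walsh_union {S T : Finset (Fin n)} (h : Disjoint S T) (x : Fin n → Bool) :
    walsh (S ∪ T) x = walsh S x * walsh T x := by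
  unfold walsh
  exact prod_union h

/-- `χ_S` does not depend on coordinates outside `S`. [folklore] -/
theorem walsh_update_of_not_mem {S : Finset (Fin n)} {i : Fin n} (hi : i ∉ S) (x : Fin n → Bool)
    (c : Bool) : walsh S (Function.update x i c) = walsh S x := by
  unfold walsh
  refine prod_congr rfl fun j hj => ?_
  rw [Function.update_of_ne (ne_of_mem_of_not_mem hj hi)]

/-- `χ_{S ∪ {i}}(x) = χ(xᵢ) χ_S(x)` for `i ∉ S`. [folklore] -/
theorem walsh_insert {S : Finset (Fin n)} {i : Fin n} (hi : i ∉ S) (x : Fin n → Bool) :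
    walsh (insert i S) x = sgn (x i) * walsh S x := by
  unfold walsh
  exact prod_insert hi

/-- `|χ_S(x)| = 1`. [folklore] -/
theorem abs_walsh (S : Finset (Fin n)) (x : Fin n → Bool) : |walsh S x| = 1 := by
  unfold walsh
  rw [abs_prod]
  exact prod_eq_one fun i _ => by cases x i <;> simp [sgn]

/-- `∑_x χ_S(x) = 0` for `S ≠ ∅`. [folklore] -/
theorem sum_walsh_eq_zero {S : Finset (Fin n)} (hS : S ≠ ∅) : ∑ x : Fin n → Bool, walsh S x = 0 := by
  have h := LowDegree.sum_walsh_mul_walsh_index S (∅ : Finset (Fin n))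
  simp only [walsh_empty, mul_one, if_neg hS] at h
  exact h

/-- Averaging over the two values of one coordinate:
`∑_x h(x) = (∑_x h(x|ᵢ←0) + ∑_x h(x|ᵢ←1)) / 2` (pair `x` with `x` flipped at `i`). [folklore] -/
theorem sum_eq_half_sum_update (h : (Fin n → Bool) → ℝ) (i : Fin n) :
    ∑ x, h x = (∑ x, h (Function.update x i false) + ∑ x, h (Function.update x i true)) / 2 := by
  have hinv : Function.Involutive (fun x : Fin n → Bool => Function.update x i (!x i)) := by
    intro x
    simp only
    rw [Function.update_idem, Function.update_self, Bool.not_not, Function.update_eq_self]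
  have key : ∀ x : Fin n → Bool, h (Function.update x i false) + h (Function.update x i true) =
      h x + h (Function.update x i (!x i)) := by
    intro x
    cases hx : x i
    · rw [show Function.update x i false = x from hx ▸ Function.update_eq_self i x]
      rfl
    · rw [show Function.update x i true = x from hx ▸ Function.update_eq_self i x, add_comm]
      rfl
  have hflip : ∑ x, h (Function.update x i (!x i)) = ∑ x, h x := Equiv.sum_comp hinv.toPerm h
  rw [← sum_add_distrib, sum_congr rfl fun x _ => key x, sum_add_distrib, hflip]
  ring

/-! ### `𝔽₂`-valued functions of bounded degree: a derivative calculus -/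

/-- The discrete derivative `D_a G (x) = G(x ⊕ a) + G(x)` (characteristic `2`). [folklore] -/
def der (a : Fin n → Bool) (G : (Fin n → Bool) → ZMod 2) : (Fin n → Bool) → ZMod 2 :=
  fun x => G (xorVec x a) + G x

/-- The translate `G(· ⊕ a)`. [folklore] -/
def shift (a : Fin n → Bool) (G : (Fin n → Bool) → ZMod 2) : (Fin n → Bool) → ZMod 2 :=
  fun x => G (xorVec x a)

/-- The restriction `xᵢ ← c` (as a function of all `n` variables). [folklore] -/
def restrict (i : Fin n) (c : Bool) (G : (Fin n → Bool) → ZMod 2) : (Fin n → Bool) → ZMod 2 :=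
  fun x => G (Function.update x i c)

/-- Unfolding `der`. [folklore] -/
@[simp] theorem der_apply (a : Fin n → Bool) (G : (Fin n → Bool) → ZMod 2) (x : Fin n → Bool) :
    der a G x = G (xorVec x a) + G x := rfl

/-- Unfolding `shift`. [folklore] -/
@[simp] theorem shift_apply (a : Fin n → Bool) (G : (Fin n → Bool) → ZMod 2) (x : Fin n → Bool) :
    shift a G x = G (xorVec x a) := rfl

/-- Unfolding `restrict`. [folklore] -/
@[simp] theorem restrict_apply (i : Fin n) (c : Bool) (G : (Fin n → Bool) → ZMod 2)
    (x : Fin n → Bool) : restrict i c G x = G (Function.update x i c) := rfl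

variable (n) in
/-- `lowDeg n d`: the `𝔽₂`-valued functions on `{0,1}ⁿ` all of whose `(d+1)`-fold mixed
derivatives `D_{a₁} ⋯ D_{a_{d+1}} G` vanish (for `d = 0`: translation invariant, i.e. constant).
These are exactly the functions of `𝔽₂`-degree `≤ d`; only the inclusion of the evaluations of
polynomials of total degree `≤ d` (`eval_mem_lowDeg`) is needed and proved here. [folklore] -/
def lowDeg : ℕ → Set ((Fin n → Bool) → ZMod 2)
  | 0 => {G | ∀ a x, G (xorVec x a) = G x}
  | d + 1 => {G | ∀ a, der a G ∈ lowDeg d}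

/-- Degree `≤ 0`: translation invariance. [folklore] -/
theorem mem_lowDeg_zero {G : (Fin n → Bool) → ZMod 2} :
    G ∈ lowDeg n 0 ↔ ∀ a x, G (xorVec x a) = G x := Iff.rfl

/-- Degree `≤ d + 1`: every derivative has degree `≤ d`. [folklore] -/
theorem mem_lowDeg_succ {G : (Fin n → Bool) → ZMod 2} {d : ℕ} :
    G ∈ lowDeg n (d + 1) ↔ ∀ a, der a G ∈ lowDeg n d := Iff.rfl

/-- Degree `≤ 0` functions are constant. [folklore] -/
theorem apply_eq_of_mem_lowDeg_zero {G : (Fin n → Bool) → ZMod 2} (h : G ∈ lowDeg n 0)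
    (x y : Fin n → Bool) : G x = G y := by
  have := h (xorVec y x) y
  rwa [xorVec_xorVec_cancel] at this

/-- Derivatives of degree-`0` functions vanish. [folklore] -/
theorem der_eq_zero_of_mem_lowDeg_zero {G : (Fin n → Bool) → ZMod 2} (h : G ∈ lowDeg n 0)
    (a : Fin n → Bool) : der a G = 0 := by
  funext x
  simp only [der_apply, Pi.zero_apply, h a x, CharTwo.add_self_eq_zero]

/-- `0` has every degree. [folklore] -/
theorem zero_mem_lowDeg : ∀ d, (0 : (Fin n → Bool) → ZMod 2) ∈ lowDeg n d
  | 0 => fun _ _ => rfl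
  | d + 1 => fun a => by
      have : der a (0 : (Fin n → Bool) → ZMod 2) = 0 := by funext x; simp
      rw [this]; exact zero_mem_lowDeg d

/-- `lowDeg n d` is closed under addition. [folklore] -/
theorem add_mem_lowDeg : ∀ (d) {G H : (Fin n → Bool) → ZMod 2},
    G ∈ lowDeg n d → H ∈ lowDeg n d → G + H ∈ lowDeg n d
  | 0, G, H, hG, hH => fun a x => by simp only [Pi.add_apply, hG a x, hH a x]
  | d + 1, G, H, hG, hH => fun a => by
      have : der a (G + H) = der a G + der a H := by
        funext x; simp only [der_apply, Pi.add_apply]; ring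
      rw [this]
      exact add_mem_lowDeg d (hG a) (hH a)

/-- `lowDeg n d` is closed under scalars. [folklore] -/
theorem smul_mem_lowDeg (c : ZMod 2) : ∀ (d) {G : (Fin n → Bool) → ZMod 2},
    G ∈ lowDeg n d → (fun x => c * G x) ∈ lowDeg n d
  | 0, G, hG => fun a x => by simp only [hG a x]
  | d + 1, G, hG => fun a => by
      have : der a (fun x => c * G x) = fun x => c * der a G x := by
        funext x; simp only [der_apply]; ring
      rw [this]
      exact smul_mem_lowDeg c d (hG a)

/-- `lowDeg n d` is closed under finite sums. [folklore] -/
theorem sum_mem_lowDeg {ι : Type*} (s : Finset ι) (f : ι → (Fin n → Bool) → ZMod 2) (d : ℕ)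
    (h : ∀ i ∈ s, f i ∈ lowDeg n d) : (∑ i ∈ s, f i) ∈ lowDeg n d :=
  sum_induction f (· ∈ lowDeg n d) (fun _ _ ha hb => add_mem_lowDeg d ha hb) (zero_mem_lowDeg d) h

/-- `lowDeg n d` is closed under translations `G(· ⊕ y)`. [folklore] -/
theorem shift_mem_lowDeg (y : Fin n → Bool) : ∀ (d) {G : (Fin n → Bool) → ZMod 2},
    G ∈ lowDeg n d → shift y G ∈ lowDeg n d
  | 0, G, hG => fun a x => by simp only [shift_apply]; rw [hG y (xorVec x a), hG a x, hG y x]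
  | d + 1, G, hG => fun a => by
      have : der a (shift y G) = shift y (der a G) := by
        funext x; simp only [der_apply, shift_apply, xorVec_right_comm x a y]
      rw [this]
      exact shift_mem_lowDeg y d (hG a)

/-- Overriding a coordinate of `x ⊕ a` = translating the overridden point by `a` with that coordinate cleared. [folklore] -/
theorem update_xorVec (x a : Fin n → Bool) (i : Fin n) (c : Bool) :
    Function.update (xorVec x a) i c = xorVec (Function.update x i c) (Function.update a i false) := by
  funext j
  by_cases hj : j = i
  · subst hj; simp
  · simp [Function.update_of_ne hj]

/-- `lowDeg n d` is closed under restrictions `xᵢ ← c` (the degree of a restriction does not go up). [folklore] -/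
theorem restrict_mem_lowDeg (i : Fin n) (c : Bool) : ∀ (d) {G : (Fin n → Bool) → ZMod 2},
    G ∈ lowDeg n d → restrict i c G ∈ lowDeg n d
  | 0, G, hG => fun a x => by
      simp only [restrict_apply]
      rw [update_xorVec, hG]
  | d + 1, G, hG => fun a => by
      have : der a (restrict i c G) = restrict i c (der (Function.update a i false) G) := by
        funext x; simp only [der_apply, restrict_apply, update_xorVec]
      rw [this]
      exact restrict_mem_lowDeg i c d (hG _)

/-- Degree `≤ d` implies degree `≤ d + 1`. [folklore] -/
theorem lowDeg_subset_succ : ∀ d, lowDeg n d ⊆ lowDeg n (d + 1)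
  | 0 => fun G hG a => by rw [der_eq_zero_of_mem_lowDeg_zero hG]; exact zero_mem_lowDeg 0
  | d + 1 => fun G hG a => lowDeg_subset_succ d (hG a)

/-- `lowDeg n d` is monotone in `d`. [folklore] -/
theorem lowDeg_mono {d d' : ℕ} (h : d ≤ d') : lowDeg n d ⊆ lowDeg n d' := by
  induction h with
  | refl => exact le_rfl
  | step _ ih => exact ih.trans (lowDeg_subset_succ _)

/-- The coordinate indicator `[xᵢ]` as an element of `𝔽₂`. [folklore] -/
def coord (i : Fin n) (x : Fin n → Bool) : ZMod 2 := if x i then 1 else 0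

/-- `[b ⊕ c] = [b] + [c]` in `𝔽₂`. [folklore] -/
theorem ite_xor_eq (b c : Bool) :
    (if xor b c then (1 : ZMod 2) else 0) = (if b then 1 else 0) + (if c then 1 else 0) := by
  revert b c; decide

/-- A coordinate of a translate: `[ (x ⊕ a)ᵢ ] = [xᵢ] + [aᵢ]`. [folklore] -/
theorem coord_xorVec (i : Fin n) (x a : Fin n → Bool) :
    coord i (xorVec x a) = coord i x + coord i a :=
  ite_xor_eq (x i) (a i)

/-- Multiplying by a coordinate raises the degree by at most one. [folklore] -/
theorem coordMul_mem_lowDeg (i : Fin n) : ∀ (m) {K : (Fin n → Bool) → ZMod 2},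
    K ∈ lowDeg n m → (fun x => coord i x * K x) ∈ lowDeg n (m + 1) := by
  intro m
  induction m with
  | zero =>
      intro K hK a
      have : der a (fun x => coord i x * K x) = fun x => coord i a * shift a K x := by
        funext x
        simp only [der_apply, shift_apply, coord_xorVec, hK a x]
        have := CharTwo.add_self_eq_zero (coord i x * K x)
        linear_combination this
      rw [this]
      exact smul_mem_lowDeg _ 0 (shift_mem_lowDeg a 0 hK)
  | succ m ih =>
      intro K hK a
      have : der a (fun x => coord i x * K x) =
          (fun x => coord i x * der a K x) + fun x => coord i a * shift a K x := by
        funext x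
        simp only [der_apply, shift_apply, coord_xorVec, Pi.add_apply]
        ring
      rw [this]
      exact add_mem_lowDeg (m + 1) (ih (hK a)) (smul_mem_lowDeg _ (m + 1) (shift_mem_lowDeg a _ hK))

/-- The monomial indicator `∏_{i ∈ T} [xᵢ]`. [folklore] -/
def ind (T : Finset (Fin n)) (x : Fin n → Bool) : ZMod 2 := if ∀ i ∈ T, x i = true then 1 else 0

/-- The monomial `∏_{i∈T} xᵢ` has degree `≤ |T|`. [folklore] -/
theorem ind_mem_lowDeg (T : Finset (Fin n)) : ind T ∈ lowDeg n T.card := by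
  induction T using Finset.induction_on with
  | empty =>
      intro a x
      simp [ind]
  | insert i T hi ih =>
      have e : ind (insert i T) = fun x => coord i x * ind T x := by
        funext x
        simp only [ind, coord, forall_mem_insert]
        by_cases h1 : x i = true <;> by_cases h2 : ∀ j ∈ T, x j = true <;> simp [h1, h2]
      rw [e, card_insert_of_notMem hi]
      exact coordMul_mem_lowDeg i _ ih

/-- Evaluating a monomial at a Boolean point gives the indicator of its support. [folklore] -/
theorem eval_boolPt_monomial (v : Fin n →₀ ℕ) (c : ZMod 2) (x : Fin n → Bool) :
    MvPolynomial.eval (Multilinear.boolPt x) (MvPolynomial.monomial v c) = c * ind v.support x := by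
  rw [MvPolynomial.eval_monomial, Finsupp.prod]
  congr 1
  have e : ∀ i ∈ v.support,
      Multilinear.boolPt x i ^ v i = (if x i = true then (1 : ZMod 2) else 0) := by
    intro i hi
    have hv : v i ≠ 0 := Finsupp.mem_support_iff.1 hi
    rw [Multilinear.boolPt_apply]
    split_ifs <;> simp [hv]
  rw [prod_congr rfl e]
  unfold ind
  split_ifs with h
  · exact prod_eq_one fun i hi => by rw [if_pos (h i hi)]
  · push Not at h
    obtain ⟨i, hi, hx⟩ := h
    exact prod_eq_zero hi (if_neg hx)

/-- A monomial exponent has at least as large a degree as its support. [folklore] -/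
theorem card_support_le_degree (v : Fin n →₀ ℕ) : v.support.card ≤ v.sum fun _ e => e := by
  rw [Finsupp.sum, card_eq_sum_ones]
  exact sum_le_sum fun i hi => Nat.one_le_iff_ne_zero.2 (Finsupp.mem_support_iff.1 hi)

/-- **Bridge**: a polynomial of total degree `≤ d` over `𝔽₂` defines a function in `lowDeg n d`.
[folklore] -/
theorem eval_mem_lowDeg {d : ℕ} (p : MvPolynomial (Fin n) (ZMod 2)) (hp : p.totalDegree ≤ d) :
    (fun x => MvPolynomial.eval (Multilinear.boolPt x) p) ∈ lowDeg n d := by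
  have e : (fun x => MvPolynomial.eval (Multilinear.boolPt x) p) =
      ∑ v ∈ p.support, fun x => MvPolynomial.coeff v p * ind v.support x := by
    funext x
    rw [Finset.sum_apply]
    conv_lhs => rw [p.as_sum]
    rw [map_sum]
    exact sum_congr rfl fun v _ => eval_boolPt_monomial v _ x
  rw [e]
  refine sum_mem_lowDeg _ _ d fun v hv => smul_mem_lowDeg _ d ?_
  exact lowDeg_mono ((card_support_le_degree v).trans ((MvPolynomial.le_totalDegree hv).trans hp))
    (ind_mem_lowDeg v.support)

/-! ### Signs and Fourier coefficients of `𝔽₂`-valued functions -/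

/-- `[u + v = 1] = [u = 1] ⊕ [v = 1]` in `𝔽₂`. [folklore] -/
theorem decide_add_eq_one (u v : ZMod 2) :
    decide (u + v = 1) = xor (decide (u = 1)) (decide (v = 1)) := by
  revert u v; decide

/-- `(-1)^{u+v} = (-1)^u (-1)^v` for `u, v ∈ 𝔽₂`, signs read through `sgn ∘ decide`. [folklore] -/
theorem sgn_decide_add (u v : ZMod 2) :
    sgn (decide (u + v = 1)) = sgn (decide (u = 1)) * sgn (decide (v = 1)) := by
  rw [decide_add_eq_one, sgn_xor]

/-- The Fourier–Walsh coefficient of `(-1)^{G}`: `Ĝ(S) = 2^{-n} ∑_x (-1)^{G x} χ_S(x)`; this is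
`boolFourierCoeff (fun x => decide (G x = 1)) S` by `rfl`. [folklore] -/
def zcoef (G : (Fin n → Bool) → ZMod 2) (S : Finset (Fin n)) : ℝ :=
  (∑ x, sgn (decide (G x = 1)) * walsh S x) / 2 ^ n

/-- The level-`k` mass `∑_{|S|=k} |Ĝ(S)|` (`= fourierL1Level (fun x => decide (G x = 1)) k`).
[folklore] -/
def zlevel (G : (Fin n → Bool) → ZMod 2) (k : ℕ) : ℝ :=
  ∑ S ∈ (univ : Finset (Fin n)).powersetCard k, |zcoef G S|

/-- Bridge to the vocabulary of the named fact: `fourierL1Level [G = 1] k = zlevel G k` (by `rfl`). [folklore] -/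
theorem fourierL1Level_eq_zlevel (G : (Fin n → Bool) → ZMod 2) (k : ℕ) :
    fourierL1Level (fun x => decide (G x = 1)) k = zlevel G k := rfl

/-- Level masses are nonnegative. [folklore] -/
theorem zlevel_nonneg (G : (Fin n → Bool) → ZMod 2) (k : ℕ) : 0 ≤ zlevel G k :=
  sum_nonneg fun _ _ => abs_nonneg _

/-- `|Ĝ(S)| ≤ 1`. [cite: ODonnell2014, §1.2] -/
theorem abs_zcoef_le_one (G : (Fin n → Bool) → ZMod 2) (S : Finset (Fin n)) : |zcoef G S| ≤ 1 :=
  LowDegree.abs_cubeFourierCoeff_le_one (fun x => sgn (decide (G x = 1)))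
    (fun x => by cases decide (G x = 1) <;> simp [sgn]) S

/-- Level `0` carries mass at most `1`. [folklore] -/
theorem zlevel_zero_le_one (G : (Fin n → Bool) → ZMod 2) : zlevel G 0 ≤ 1 := by
  unfold zlevel
  rw [powersetCard_zero, sum_singleton]
  exact abs_zcoef_le_one G ∅

/-- Constant functions have no mass at positive levels. [folklore] -/
theorem zlevel_eq_zero_of_const {G : (Fin n → Bool) → ZMod 2} (hG : ∀ x y, G x = G y) {k : ℕ}
    (hk : 1 ≤ k) : zlevel G k = 0 := by
  unfold zlevel
  refine sum_eq_zero fun S hS => ?_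
  have hSne : S ≠ ∅ := by
    rintro rfl
    rw [mem_powersetCard, card_empty] at hS
    omega
  have e : ∀ x, sgn (decide (G x = 1)) * walsh S x = sgn (decide (G (fun _ => false) = 1)) * walsh S x := fun x => by
    rw [hG x fun _ => false]
  rw [zcoef, sum_congr rfl fun x _ => e x, ← mul_sum, sum_walsh_eq_zero hSne]
  simp

/-! ### Claim 6.3: restrictions -/

/-- `Ĝ(B ∪ {i}) = (Ĝ_{i←0}(B) − Ĝ_{i←1}(B)) / 2` for `i ∉ B`. [cite: ChattopadhyayEtAl2019, §6 proof of Claim 6.3] -/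
theorem zcoef_insert (G : (Fin n → Bool) → ZMod 2) {B : Finset (Fin n)} {i : Fin n} (hi : i ∉ B) :
    zcoef G (insert i B) =
      (zcoef (restrict i false G) B - zcoef (restrict i true G) B) / 2 := by
  unfold zcoef
  rw [sum_eq_half_sum_update (fun x => sgn (decide (G x = 1)) * walsh (insert i B) x) i]
  have e : ∀ (c : Bool) (x : Fin n → Bool),
      sgn (decide (G (Function.update x i c) = 1)) * walsh (insert i B) (Function.update x i c) =
        sgn c * (sgn (decide (restrict i c G x = 1)) * walsh B x) := by
    intro c x
    rw [walsh_insert hi, Function.update_self, walsh_update_of_not_mem hi, restrict_apply]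
    ring
  simp_rw [e, ← mul_sum, sgn_false, sgn_true]
  ring

/-- **Claim 6.3** (CHHL): if every function of the class has level-`j` mass `≤ C`, then for every
`A` with `|A| = a` the mass of the `(a+j)`-sets containing `A` is `≤ C` (induction on `a`, by
restricting one variable of `A`). [cite: ChattopadhyayEtAl2019, Claim 6.3] -/
theorem claim63 {d j : ℕ} {C : ℝ} (hC : ∀ G ∈ lowDeg n d, zlevel G j ≤ C) :
    ∀ (a : ℕ) (G : (Fin n → Bool) → ZMod 2), G ∈ lowDeg n d → ∀ A : Finset (Fin n), A.card = a →
      ∑ B ∈ (univ.powersetCard (a + j)).filter (fun B => A ⊆ B), |zcoef G B| ≤ C := by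
  intro a
  induction a with
  | zero =>
      intro G hG A hA
      rw [card_eq_zero] at hA
      subst hA
      rw [zero_add, filter_true_of_mem fun B _ => empty_subset B]
      exact hC G hG
  | succ a ih =>
      intro G hG A hA
      obtain ⟨i, hiA⟩ : A.Nonempty := card_pos.1 (by omega)
      set 𝔅 := (univ.powersetCard (a + 1 + j)).filter (fun B => A ⊆ B) with h𝔅
      have hiB : ∀ B ∈ 𝔅, i ∈ B := fun B hB => (mem_filter.1 hB).2 hiA
      have hpt : ∀ B ∈ 𝔅, |zcoef G B| ≤
          (|zcoef (restrict i false G) (B.erase i)| + |zcoef (restrict i true G) (B.erase i)|) / 2 := by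
        intro B hB
        conv_lhs => rw [← insert_erase (hiB B hB)]
        rw [zcoef_insert G (notMem_erase i B), abs_div, abs_two]
        gcongr
        exact abs_sub _ _
      have hrest : ∀ c : Bool, ∑ B ∈ 𝔅, |zcoef (restrict i c G) (B.erase i)| ≤ C := by
        intro c
        have hinj : Set.InjOn (fun B : Finset (Fin n) => B.erase i) 𝔅 := by
          intro B₁ h₁ B₂ h₂ h
          have h' : B₁.erase i = B₂.erase i := h
          rw [← insert_erase (hiB B₁ h₁), ← insert_erase (hiB B₂ h₂), h']
        rw [← sum_image (f := fun B' => |zcoef (restrict i c G) B'|) hinj]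
        refine le_trans (sum_le_sum_of_subset_of_nonneg ?_ fun _ _ _ => abs_nonneg _)
          (ih (restrict i c G) (restrict_mem_lowDeg i c d hG) (A.erase i) ?_)
        · intro B' hB'
          obtain ⟨B, hB, rfl⟩ := mem_image.1 hB'
          have hB₁ := mem_filter.1 hB
          have hcard := (mem_powersetCard.1 hB₁.1).2
          refine mem_filter.2 ⟨mem_powersetCard.2 ⟨subset_univ _, ?_⟩, erase_subset_erase i hB₁.2⟩
          rw [card_erase_of_mem (hiB B hB), hcard]
          omega
        · rw [card_erase_of_mem hiA, hA]
          rfl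
      calc ∑ B ∈ 𝔅, |zcoef G B|
          ≤ ∑ B ∈ 𝔅, (|zcoef (restrict i false G) (B.erase i)| +
              |zcoef (restrict i true G) (B.erase i)|) / 2 := sum_le_sum hpt
        _ = (∑ B ∈ 𝔅, |zcoef (restrict i false G) (B.erase i)| +
              ∑ B ∈ 𝔅, |zcoef (restrict i true G) (B.erase i)|) / 2 := by
            rw [← sum_add_distrib, sum_div]
        _ ≤ (C + C) / 2 := by gcongr <;> exact hrest _
        _ = C := by ring

/-- Claim 6.3 in indicator form: `∑_{|S| = a + j} [L ⊆ S] |Ĝ(S)| ≤ C` for `|L| = a`.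
[cite: ChattopadhyayEtAl2019, Claim 6.3] -/
theorem claim63' {d j a : ℕ} {C : ℝ} (hC : ∀ G ∈ lowDeg n d, zlevel G j ≤ C)
    {G : (Fin n → Bool) → ZMod 2} (hG : G ∈ lowDeg n d) {L : Finset (Fin n)} (hL : L.card = a) :
    ∑ S ∈ univ.powersetCard (a + j), (if L ⊆ S then |zcoef G S| else 0) ≤ C := by
  rw [← sum_filter]
  exact claim63 hC a G hG L hL

/-! ### Counting subsets -/

/-- `#{L : |L| = ℓ, L ⊆ S} = (|S| choose ℓ)`. [folklore] -/
theorem card_filter_subset (S : Finset (Fin n)) (ℓ : ℕ) :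
    ((univ.powersetCard ℓ).filter fun L => L ⊆ S).card = S.card.choose ℓ := by
  rw [← card_powersetCard ℓ S]
  congr 1
  ext L
  simp only [mem_filter, mem_powersetCard, subset_univ, true_and]
  exact and_comm

/-- `∑_{|L| = ℓ} [L ⊆ S] c = (|S| choose ℓ) c`. [folklore] -/
theorem sum_ite_subset (S : Finset (Fin n)) (ℓ : ℕ) (c : ℝ) :
    ∑ L ∈ univ.powersetCard ℓ, (if L ⊆ S then c else 0) = (S.card.choose ℓ : ℝ) * c := by
  rw [← sum_filter, sum_const, card_filter_subset, nsmul_eq_mul]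

/-! ### Claim 6.5: pairs meeting in `ℓ ≥ 1` points -/

/-- **Claim 6.5** (CHHL), for an arbitrary function of the class:
`∑_{|S|=|T|=k, |S∩T|=ℓ} |Ĝ(S)||Ĝ(T)| ≤ (k choose ℓ) · C_{k-ℓ} · W_k(G)` where `C_{k-ℓ}` bounds the
level-`(k-ℓ)` mass over the class. [cite: ChattopadhyayEtAl2019, Claim 6.5] -/
theorem claim65 {d k ℓ : ℕ} {C : ℝ} (hℓk : ℓ ≤ k) (hC : ∀ G ∈ lowDeg n d, zlevel G (k - ℓ) ≤ C)
    {G : (Fin n → Bool) → ZMod 2} (hG : G ∈ lowDeg n d) :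
    ∑ S ∈ univ.powersetCard k, ∑ T ∈ univ.powersetCard k,
        (if (S ∩ T).card = ℓ then |zcoef G S| * |zcoef G T| else 0)
      ≤ (k.choose ℓ : ℝ) * C * zlevel G k := by
  have hg0 : ∀ S, 0 ≤ |zcoef G S| := fun S => abs_nonneg _
  -- `X L = ∑_{S ⊇ L} |Ĝ(S)|`
  have hX0 : ∀ L : Finset (Fin n),
      0 ≤ ∑ S ∈ univ.powersetCard k, (if L ⊆ S then |zcoef G S| else 0) :=
    fun L => sum_nonneg fun S _ => by split_ifs; exacts [hg0 S, le_rfl]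
  have hXC : ∀ L ∈ (univ : Finset (Fin n)).powersetCard ℓ,
      ∑ S ∈ univ.powersetCard k, (if L ⊆ S then |zcoef G S| else 0) ≤ C := by
    intro L hL
    have h := claim63' (a := ℓ) (j := k - ℓ) hC hG (mem_powersetCard.1 hL).2
    rwa [Nat.add_sub_cancel' hℓk] at h
  have hnn : ∀ S T (L : Finset (Fin n)),
      0 ≤ (if L ⊆ S ∧ L ⊆ T then |zcoef G S| * |zcoef G T| else 0) :=
    fun S T L => by split_ifs; exacts [mul_nonneg (hg0 S) (hg0 T), le_rfl]
  have hpt : ∀ S T : Finset (Fin n),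
      (if (S ∩ T).card = ℓ then |zcoef G S| * |zcoef G T| else 0) ≤
        ∑ L ∈ univ.powersetCard ℓ, (if L ⊆ S ∧ L ⊆ T then |zcoef G S| * |zcoef G T| else 0) := by
    intro S T
    split_ifs with h
    · have hmem : S ∩ T ∈ (univ : Finset (Fin n)).powersetCard ℓ :=
        mem_powersetCard.2 ⟨subset_univ _, h⟩
      refine le_trans (le_of_eq ?_) (single_le_sum (fun L _ => hnn S T L) hmem)
      rw [if_pos ⟨inter_subset_left, inter_subset_right⟩]
    · exact sum_nonneg fun L _ => hnn S T L
  calc ∑ S ∈ univ.powersetCard k, ∑ T ∈ univ.powersetCard k,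
          (if (S ∩ T).card = ℓ then |zcoef G S| * |zcoef G T| else 0)
      ≤ ∑ S ∈ univ.powersetCard k, ∑ T ∈ univ.powersetCard k, ∑ L ∈ univ.powersetCard ℓ,
          (if L ⊆ S ∧ L ⊆ T then |zcoef G S| * |zcoef G T| else 0) :=
        sum_le_sum fun S _ => sum_le_sum fun T _ => hpt S T
    _ = ∑ L ∈ univ.powersetCard ℓ,
          (∑ S ∈ univ.powersetCard k, (if L ⊆ S then |zcoef G S| else 0)) *
          (∑ T ∈ univ.powersetCard k, (if L ⊆ T then |zcoef G T| else 0)) := by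
        have e1 : ∀ S ∈ (univ : Finset (Fin n)).powersetCard k,
            ∑ T ∈ univ.powersetCard k, ∑ L ∈ univ.powersetCard ℓ,
              (if L ⊆ S ∧ L ⊆ T then |zcoef G S| * |zcoef G T| else 0) =
            ∑ L ∈ univ.powersetCard ℓ, ∑ T ∈ univ.powersetCard k,
              (if L ⊆ S ∧ L ⊆ T then |zcoef G S| * |zcoef G T| else 0) :=
          fun S _ => sum_comm
        rw [sum_congr rfl e1, sum_comm]
        refine sum_congr rfl fun L _ => ?_
        rw [sum_mul_sum]
        refine sum_congr rfl fun S _ => sum_congr rfl fun T _ => ?_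
        rw [ite_zero_mul_ite_zero]
    _ ≤ ∑ L ∈ univ.powersetCard ℓ,
          C * ∑ T ∈ univ.powersetCard k, (if L ⊆ T then |zcoef G T| else 0) :=
        sum_le_sum fun L hL => mul_le_mul_of_nonneg_right (hXC L hL) (hX0 L)
    _ = C * ((k.choose ℓ : ℝ) * zlevel G k) := by
        rw [← mul_sum]
        congr 1
        rw [sum_comm, zlevel, mul_sum]
        refine sum_congr rfl fun T hT => ?_
        rw [sum_ite_subset, (mem_powersetCard.1 hT).2]
    _ = (k.choose ℓ : ℝ) * C * zlevel G k := by ring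

/-! ### Claim 6.4: disjoint pairs, through the derivative -/

/-- The key identity behind Claim 6.4: for disjoint `S, T`,
`Ĝ(S) Ĝ(T) = 2^{-2n} ∑_{y,z} χ_S(y) χ_T(z) ĥ_{y,z}(S ∪ T)` where
`h_{y,z}(x) = (-1)^{G(x⊕y) + G(x⊕z)}` is (a translate of) the derivative of `G` in direction
`y ⊕ z`. [cite: ChattopadhyayEtAl2019, §6 proof of Claim 6.4] -/
theorem zcoef_mul_zcoef (G : (Fin n → Bool) → ZMod 2) {S T : Finset (Fin n)} (hST : Disjoint S T) :
    zcoef G S * zcoef G T =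
      (∑ y, ∑ z, walsh S y * walsh T z * zcoef (shift y (der (xorVec y z) G)) (S ∪ T)) /
        (2 ^ n) ^ 2 := by
  have hA : ∀ (R : Finset (Fin n)) (x : Fin n → Bool),
      ∑ y, sgn (decide (G (xorVec x y) = 1)) * (walsh R x * walsh R y) = ∑ y, sgn (decide (G y = 1)) * walsh R y := by
    intro R x
    calc ∑ y, sgn (decide (G (xorVec x y) = 1)) * (walsh R x * walsh R y)
        = ∑ y, (fun w => sgn (decide (G w = 1)) * walsh R w) (xorVec x y) :=
          sum_congr rfl fun y _ => by simp only [walsh_xorVec]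
      _ = ∑ y, sgn (decide (G y = 1)) * walsh R y := sum_comp_xorVec (fun w => sgn (decide (G w = 1)) * walsh R w) x
  have term : ∀ y z, walsh S y * walsh T z * zcoef (shift y (der (xorVec y z) G)) (S ∪ T) =
      (∑ x, (sgn (decide (G (xorVec x y) = 1)) * (walsh S x * walsh S y)) *
        (sgn (decide (G (xorVec x z) = 1)) * (walsh T x * walsh T z))) / 2 ^ n := by
    intro y z
    unfold zcoef
    rw [mul_div_assoc', mul_sum]
    congr 1
    refine sum_congr rfl fun x _ => ?_
    rw [shift_apply, der_apply, xorVec_xorVec_xorVec, sgn_decide_add, walsh_union hST]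
    ring
  simp_rw [term]
  simp_rw [← sum_div]
  have swap : ∑ y, ∑ z, ∑ x, (sgn (decide (G (xorVec x y) = 1)) * (walsh S x * walsh S y)) *
        (sgn (decide (G (xorVec x z) = 1)) * (walsh T x * walsh T z)) =
      ∑ _x : Fin n → Bool, (∑ y, sgn (decide (G y = 1)) * walsh S y) * (∑ z, sgn (decide (G z = 1)) * walsh T z) := by
    calc ∑ y, ∑ z, ∑ x, (sgn (decide (G (xorVec x y) = 1)) * (walsh S x * walsh S y)) *
            (sgn (decide (G (xorVec x z) = 1)) * (walsh T x * walsh T z))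
        = ∑ y, ∑ x, ∑ z, (sgn (decide (G (xorVec x y) = 1)) * (walsh S x * walsh S y)) *
            (sgn (decide (G (xorVec x z) = 1)) * (walsh T x * walsh T z)) := sum_congr rfl fun y _ => sum_comm
      _ = ∑ x, ∑ y, ∑ z, (sgn (decide (G (xorVec x y) = 1)) * (walsh S x * walsh S y)) *
            (sgn (decide (G (xorVec x z) = 1)) * (walsh T x * walsh T z)) := sum_comm
      _ = ∑ x, (∑ y, sgn (decide (G (xorVec x y) = 1)) * (walsh S x * walsh S y)) *
            (∑ z, sgn (decide (G (xorVec x z) = 1)) * (walsh T x * walsh T z)) :=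
          sum_congr rfl fun x _ => (sum_mul_sum _ _ _ _).symm
      _ = ∑ _x : Fin n → Bool, (∑ y, sgn (decide (G y = 1)) * walsh S y) * (∑ z, sgn (decide (G z = 1)) * walsh T z) :=
          sum_congr rfl fun x _ => by rw [hA S x, hA T x]
  rw [swap, sum_const, card_univ, Fintype.card_fun, Fintype.card_bool, Fintype.card_fin, nsmul_eq_mul]
  unfold zcoef
  have h2 : (2 : ℝ) ^ n ≠ 0 := by positivity
  push_cast
  field_simp

/-- Reordering a fourfold sum. [folklore] -/
theorem sum_comm4 {α β γ δ : Type*} (s : Finset α) (t : Finset β) (u : Finset γ) (v : Finset δ)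
    (F : α → β → γ → δ → ℝ) :
    ∑ a ∈ s, ∑ b ∈ t, ∑ c ∈ u, ∑ d ∈ v, F a b c d =
      ∑ c ∈ u, ∑ d ∈ v, ∑ a ∈ s, ∑ b ∈ t, F a b c d := by
  calc ∑ a ∈ s, ∑ b ∈ t, ∑ c ∈ u, ∑ d ∈ v, F a b c d
      = ∑ a ∈ s, ∑ c ∈ u, ∑ b ∈ t, ∑ d ∈ v, F a b c d := sum_congr rfl fun a _ => sum_comm
    _ = ∑ c ∈ u, ∑ a ∈ s, ∑ b ∈ t, ∑ d ∈ v, F a b c d := sum_comm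
    _ = ∑ c ∈ u, ∑ a ∈ s, ∑ d ∈ v, ∑ b ∈ t, F a b c d :=
        sum_congr rfl fun c _ => sum_congr rfl fun a _ => sum_comm
    _ = ∑ c ∈ u, ∑ d ∈ v, ∑ a ∈ s, ∑ b ∈ t, F a b c d := sum_congr rfl fun c _ => sum_comm

/-- The summand of Claim 6.4 after differentiation: `[S ∩ T = ∅] |ĥ_{y,z}(S ∪ T)|`. [folklore] -/
def pairTerm (G : (Fin n → Bool) → ZMod 2) (y z : Fin n → Bool) (S T : Finset (Fin n)) : ℝ :=
  if Disjoint S T then |zcoef (shift y (der (xorVec y z) G)) (S ∪ T)| else 0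

/-- `pairTerm ≥ 0`. [folklore] -/
theorem pairTerm_nonneg (G : (Fin n → Bool) → ZMod 2) (y z : Fin n → Bool) (S T : Finset (Fin n)) :
    0 ≤ pairTerm G y z S T := by
  unfold pairTerm; split_ifs; exacts [abs_nonneg _, le_rfl]

/-- Pair counting: `∑_{|S|=|T|=k, S∩T=∅} φ(S ∪ T) ≤ (2k choose k) ∑_{|R|=2k} φ(R)` for `φ ≥ 0`.
[folklore] -/
theorem sum_disjoint_pairs_le (φ : Finset (Fin n) → ℝ) (hφ : ∀ R, 0 ≤ φ R) (k : ℕ) :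
    ∑ S ∈ univ.powersetCard k, ∑ T ∈ univ.powersetCard k, (if Disjoint S T then φ (S ∪ T) else 0)
      ≤ ((2 * k).choose k : ℝ) * ∑ R ∈ univ.powersetCard (2 * k), φ R := by
  have step1 : ∀ S ∈ (univ : Finset (Fin n)).powersetCard k, ∀ T ∈ (univ : Finset (Fin n)).powersetCard k,
      (if Disjoint S T then φ (S ∪ T) else 0) =
        ∑ R ∈ univ.powersetCard (2 * k), (if Disjoint S T ∧ S ∪ T = R then φ R else 0) := by
    intro S hS T hT
    by_cases h : Disjoint S T
    · have hR : S ∪ T ∈ (univ : Finset (Fin n)).powersetCard (2 * k) := by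
        rw [mem_powersetCard, card_union_of_disjoint h, (mem_powersetCard.1 hS).2,
          (mem_powersetCard.1 hT).2]
        exact ⟨subset_univ _, by ring⟩
      simp only [h, true_and, if_true]
      rw [sum_ite_eq, if_pos hR]
    · simp [h]
  have step2 : ∀ (R S : Finset (Fin n)),
      ∑ T ∈ univ.powersetCard k, (if Disjoint S T ∧ S ∪ T = R then φ R else 0) ≤
        (if S ⊆ R then φ R else 0) := by
    intro R S
    rw [← sum_filter]
    have hsub : (univ.powersetCard k).filter (fun T => Disjoint S T ∧ S ∪ T = R) ⊆ {R \ S} := by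
      intro T hT
      obtain ⟨hd, rfl⟩ := (mem_filter.1 hT).2
      rw [mem_singleton, union_sdiff_cancel_left hd]
    split_ifs with hSR
    · calc ∑ T ∈ (univ.powersetCard k).filter (fun T => Disjoint S T ∧ S ∪ T = R), φ R
          ≤ ∑ T ∈ {R \ S}, φ R := sum_le_sum_of_subset_of_nonneg hsub fun _ _ _ => hφ R
        _ = φ R := sum_singleton _ _
    · refine (sum_eq_zero fun T hT => ?_).le
      obtain ⟨_, rfl⟩ := (mem_filter.1 hT).2
      exact absurd subset_union_left hSR
  calc ∑ S ∈ univ.powersetCard k, ∑ T ∈ univ.powersetCard k, (if Disjoint S T then φ (S ∪ T) else 0)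
      = ∑ S ∈ univ.powersetCard k, ∑ T ∈ univ.powersetCard k,
          ∑ R ∈ univ.powersetCard (2 * k), (if Disjoint S T ∧ S ∪ T = R then φ R else 0) :=
        sum_congr rfl fun S hS => sum_congr rfl fun T hT => step1 S hS T hT
    _ = ∑ R ∈ univ.powersetCard (2 * k), ∑ S ∈ univ.powersetCard k, ∑ T ∈ univ.powersetCard k,
          (if Disjoint S T ∧ S ∪ T = R then φ R else 0) :=
        (sum_congr rfl fun _ _ => sum_comm).trans sum_comm
    _ ≤ ∑ R ∈ univ.powersetCard (2 * k), ∑ S ∈ univ.powersetCard k, (if S ⊆ R then φ R else 0) :=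
        sum_le_sum fun R _ => sum_le_sum fun S _ => step2 R S
    _ = ∑ R ∈ univ.powersetCard (2 * k), ((2 * k).choose k : ℝ) * φ R := by
        refine sum_congr rfl fun R hR => ?_
        rw [sum_ite_subset, (mem_powersetCard.1 hR).2]
    _ = ((2 * k).choose k : ℝ) * ∑ R ∈ univ.powersetCard (2 * k), φ R := by rw [mul_sum]

/-- **Claim 6.4** (CHHL), for an arbitrary function `G` with `D_a G` in the class for all `a`:
`∑_{|S|=|T|=k, S∩T=∅} |Ĝ(S)||Ĝ(T)| ≤ (2k choose k) · C'` where `C'` bounds the level-`2k` mass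
over the class (the paper bounds `(2k choose k) ≤ 2^{2k}`). [cite: ChattopadhyayEtAl2019, Claim 6.4] -/
theorem claim64 {d k : ℕ} {C : ℝ} (hC : ∀ H ∈ lowDeg n d, zlevel H (2 * k) ≤ C)
    {G : (Fin n → Bool) → ZMod 2} (hG : G ∈ lowDeg n (d + 1)) :
    ∑ S ∈ univ.powersetCard k, ∑ T ∈ univ.powersetCard k,
        (if Disjoint S T then |zcoef G S| * |zcoef G T| else 0) ≤ ((2 * k).choose k : ℝ) * C := by
  have h4 : (0 : ℝ) < (2 ^ n) ^ 2 := by positivity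
  -- pointwise: `|Ĝ(S)||Ĝ(T)| ≤ 2^{-2n} ∑_{y,z} |ĥ_{y,z}(S ∪ T)|`
  have hpt : ∀ S T : Finset (Fin n), Disjoint S T → |zcoef G S| * |zcoef G T| ≤
      (∑ y, ∑ z, |zcoef (shift y (der (xorVec y z) G)) (S ∪ T)|) / (2 ^ n) ^ 2 := by
    intro S T hST
    rw [← abs_mul, zcoef_mul_zcoef G hST, abs_div, abs_of_pos h4]
    gcongr
    refine (abs_sum_le_sum_abs _ _).trans (sum_le_sum fun y _ => ?_)
    refine (abs_sum_le_sum_abs _ _).trans (sum_le_sum fun z _ => ?_)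
    rw [abs_mul, abs_mul, abs_walsh, abs_walsh, one_mul, one_mul]
  -- the functions `h_{y,z}` are in the class
  have hH : ∀ y z, shift y (der (xorVec y z) G) ∈ lowDeg n d :=
    fun y z => shift_mem_lowDeg y d (hG (xorVec y z))
  calc ∑ S ∈ univ.powersetCard k, ∑ T ∈ univ.powersetCard k,
          (if Disjoint S T then |zcoef G S| * |zcoef G T| else 0)
      ≤ ∑ S ∈ univ.powersetCard k, ∑ T ∈ univ.powersetCard k, ∑ y, ∑ z,
          pairTerm G y z S T / (2 ^ n) ^ 2 := by
        refine sum_le_sum fun S _ => sum_le_sum fun T _ => ?_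
        split_ifs with h
        · refine (hpt S T h).trans (le_of_eq ?_)
          simp_rw [sum_div, pairTerm, if_pos h]
        · exact sum_nonneg fun y _ => sum_nonneg fun z _ =>
            div_nonneg (pairTerm_nonneg G y z S T) h4.le
    _ = (∑ y : Fin n → Bool, ∑ z : Fin n → Bool, ∑ S ∈ univ.powersetCard k,
          ∑ T ∈ univ.powersetCard k, pairTerm G y z S T) / (2 ^ n) ^ 2 := by
        simp_rw [← sum_div]
        rw [sum_comm4]
    _ ≤ (∑ _y : Fin n → Bool, ∑ _z : Fin n → Bool, ((2 * k).choose k : ℝ) * C) / (2 ^ n) ^ 2 := by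
        gcongr with y _ z _
        exact (sum_disjoint_pairs_le (fun R => |zcoef (shift y (der (xorVec y z) G)) R|)
          (fun R => abs_nonneg _) k).trans
          (mul_le_mul_of_nonneg_left (hC _ (hH y z)) (Nat.cast_nonneg _))
    _ = ((2 * k).choose k : ℝ) * C := by
        rw [sum_const, sum_const, card_univ, Fintype.card_fun, Fintype.card_bool, Fintype.card_fin]
        simp only [nsmul_eq_mul]
        push_cast
        field_simp


/-! ### Lemma 6.2 and the double induction -/

/-- `W_k(G)² = ∑_{ℓ=0}^{k} ∑_{|S|=|T|=k, |S∩T|=ℓ} |Ĝ(S)||Ĝ(T)|` (first lines of the proof of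
Lemma 6.2). [cite: ChattopadhyayEtAl2019, Lemma 6.2] -/
theorem zlevel_sq_eq (G : (Fin n → Bool) → ZMod 2) (k : ℕ) :
    zlevel G k ^ 2 = ∑ ℓ ∈ range (k + 1), ∑ S ∈ univ.powersetCard k, ∑ T ∈ univ.powersetCard k,
      (if (S ∩ T).card = ℓ then |zcoef G S| * |zcoef G T| else 0) := by
  rw [zlevel, sq, sum_mul_sum]
  have e : ∀ S ∈ (univ : Finset (Fin n)).powersetCard k, ∀ T ∈ (univ : Finset (Fin n)).powersetCard k,
      |zcoef G S| * |zcoef G T| =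
        ∑ ℓ ∈ range (k + 1), (if (S ∩ T).card = ℓ then |zcoef G S| * |zcoef G T| else 0) := by
    intro S hS T _
    rw [sum_ite_eq, if_pos]
    rw [mem_range]
    exact Nat.lt_succ_of_le ((card_le_card inter_subset_left).trans (mem_powersetCard.1 hS).2.le)
  rw [sum_congr rfl fun S hS => sum_congr rfl fun T hT => e S hS T hT]
  exact (sum_congr rfl fun _ _ => sum_comm).trans sum_comm

/-- The bound of Theorem 6.1: `M(d, k) = (k · 2^{3d})^k` (`M(d, 0) = 1`). [cite: ChattopadhyayEtAl2019, Thm. 6.1] -/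
def bound (d k : ℕ) : ℝ := ((k : ℝ) * 2 ^ (3 * d)) ^ k

/-- `M(d, 0) = 1`. [folklore] -/
theorem bound_zero_right (d : ℕ) : bound d 0 = 1 := by simp [bound]

/-- `M(d, k) ≥ 0`. [folklore] -/
theorem bound_nonneg (d k : ℕ) : 0 ≤ bound d k := by unfold bound; positivity

/-- The contradiction step of the proof of Theorem 6.1: `W² ≤ A + W·B` and `A/M + B ≤ M` force
`W ≤ M`. [cite: ChattopadhyayEtAl2019, proof of Thm. 6.1] -/
theorem le_of_sq_le {W A B M : ℝ} (hM : 0 < M) (hA : 0 ≤ A) (hW : 0 ≤ W)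
    (h : W ^ 2 ≤ A + W * B) (hAB : A / M + B ≤ M) : W ≤ M := by
  by_contra hlt
  push Not at hlt
  have hAM : A ≤ A / M * W := by
    rw [div_mul_eq_mul_div, le_div_iff₀ hM]
    nlinarith
  have hsq : W ^ 2 ≤ W * M :=
    calc W ^ 2 ≤ A + W * B := h
      _ ≤ A / M * W + W * B := by linarith
      _ = W * (A / M + B) := by ring
      _ ≤ W * M := mul_le_mul_of_nonneg_left hAB hW
  nlinarith [mul_lt_mul_of_pos_left hlt (hM.trans hlt)]

/-- First term: `(2k choose k) · M(d', 2k) / M(d'+1, k) ≤ (2k · 2^{3d'})^k`. [cite: ChattopadhyayEtAl2019, proof of Thm. 6.1] -/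
theorem choose_mul_bound_div_le (d' k : ℕ) (hk : 1 ≤ k) :
    ((2 * k).choose k : ℝ) * bound d' (2 * k) / bound (d' + 1) k ≤
      (2 * (k : ℝ) * 2 ^ (3 * d')) ^ k := by
  have hk0 : 0 < k := hk
  have hB : bound (d' + 1) k = (8 * (k : ℝ) * 2 ^ (3 * d')) ^ k := by
    unfold bound
    congr 1
    rw [show 3 * (d' + 1) = 3 * d' + 3 by ring, pow_add]
    norm_num
    ring
  have hA : bound d' (2 * k) = ((2 * (k : ℝ) * 2 ^ (3 * d')) ^ 2) ^ k := by
    unfold bound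
    rw [← pow_mul]
    congr 1
    push_cast; ring
  have hc : ((2 * k).choose k : ℝ) ≤ 4 ^ k := by
    have h := Nat.choose_le_two_pow (2 * k) k
    calc ((2 * k).choose k : ℝ) ≤ ((2 ^ (2 * k) : ℕ) : ℝ) := by exact_mod_cast h
      _ = 4 ^ k := by rw [Nat.cast_pow, pow_mul]; norm_num
  rw [hA, hB, div_le_iff₀ (by positivity)]
  calc ((2 * k).choose k : ℝ) * ((2 * (k : ℝ) * 2 ^ (3 * d')) ^ 2) ^ k
      ≤ 4 ^ k * ((2 * (k : ℝ) * 2 ^ (3 * d')) ^ 2) ^ k := by gcongr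
    _ = (2 * (k : ℝ) * 2 ^ (3 * d')) ^ k * (8 * (k : ℝ) * 2 ^ (3 * d')) ^ k := by
        rw [← mul_pow, ← mul_pow]
        congr 1
        ring

/-- Second term: `∑_{ℓ=1}^{k} (k choose ℓ) M(d, k-ℓ) ≤ (1 + c)^k − c^k`, `c = (k-1) 2^{3d}`
(binomial theorem). [cite: ChattopadhyayEtAl2019, proof of Thm. 6.1] -/
theorem sum_choose_mul_bound_le (d k : ℕ) :
    ∑ ℓ ∈ range k, (k.choose (ℓ + 1) : ℝ) * bound d (k - (ℓ + 1)) ≤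
      (1 + ((k - 1 : ℕ) : ℝ) * 2 ^ (3 * d)) ^ k - (((k - 1 : ℕ) : ℝ) * 2 ^ (3 * d)) ^ k := by
  set c : ℝ := ((k - 1 : ℕ) : ℝ) * 2 ^ (3 * d)
  have hterm : ∀ ℓ ∈ range k, (k.choose (ℓ + 1) : ℝ) * bound d (k - (ℓ + 1)) ≤
      (k.choose (ℓ + 1) : ℝ) * c ^ (k - (ℓ + 1)) := by
    intro ℓ _
    refine mul_le_mul_of_nonneg_left ?_ (Nat.cast_nonneg _)
    unfold bound
    refine pow_le_pow_left₀ (by positivity) (mul_le_mul_of_nonneg_right ?_ (by positivity)) _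
    exact_mod_cast (show k - (ℓ + 1) ≤ k - 1 by omega)
  refine (sum_le_sum hterm).trans (le_of_eq ?_)
  have hbin := add_pow (1 : ℝ) c k
  rw [sum_range_succ'] at hbin
  simp only [one_pow, one_mul, Nat.sub_zero, Nat.choose_zero_right, Nat.cast_one, mul_one] at hbin
  rw [hbin, add_sub_cancel_right]
  exact sum_congr rfl fun ℓ _ => mul_comm _ _

/-- The final numerical inequality: `(2k·2^{3d'})^k + (1+c)^k − c^k ≤ (k·2^{3(d'+1)})^k` with
`c = (k-1)·2^{3(d'+1)}` (cases `k = 1` and `k ≥ 2`). [cite: ChattopadhyayEtAl2019, proof of Thm. 6.1] -/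
theorem numeric_ineq (d' k : ℕ) (hk : 1 ≤ k) :
    (2 * (k : ℝ) * 2 ^ (3 * d')) ^ k +
      ((1 + ((k - 1 : ℕ) : ℝ) * 2 ^ (3 * (d' + 1))) ^ k -
        (((k - 1 : ℕ) : ℝ) * 2 ^ (3 * (d' + 1))) ^ k) ≤ bound (d' + 1) k := by
  have e3 : (2 : ℝ) ^ (3 * (d' + 1)) = 8 * 2 ^ (3 * d') := by
    rw [show 3 * (d' + 1) = 3 * d' + 3 by ring, pow_add]; norm_num; ring
  unfold bound
  rw [e3]
  set v : ℝ := 2 ^ (3 * d') with hv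
  have hv1 : 1 ≤ v := one_le_pow₀ (by norm_num)
  have hcast : ((k - 1 : ℕ) : ℝ) = k - 1 := by rw [Nat.cast_sub hk, Nat.cast_one]
  rw [hcast]
  obtain rfl | hk2 := eq_or_lt_of_le hk
  · norm_num
    linarith
  · have hk2' : (2 : ℝ) ≤ k := by exact_mod_cast hk2
    have h1 : (2 * (k : ℝ) * v) ^ k ≤ ((k - 1) * (8 * v)) ^ k :=
      pow_le_pow_left₀ (by positivity) (by nlinarith) k
    have h2 : (1 + ((k : ℝ) - 1) * (8 * v)) ^ k ≤ ((k : ℝ) * (8 * v)) ^ k :=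
      pow_le_pow_left₀ (add_nonneg zero_le_one (mul_nonneg (by linarith) (by positivity)))
        (by nlinarith) k
    linarith

/-- **Theorem 6.1 for the derivative classes**: every `G ∈ lowDeg n d` has
`∑_{|S|=k} |Ĝ(S)| ≤ (k · 2^{3d})^k`, by induction on `d` (base `d = 0`: constants) and, inside,
strong induction on `k` through Lemma 6.2 = Claims 6.4 + 6.5. [cite: ChattopadhyayEtAl2019, Thm. 6.1 and Lemma 6.2] -/
theorem zlevel_le_bound (d : ℕ) : ∀ (k : ℕ) (G : (Fin n → Bool) → ZMod 2), G ∈ lowDeg n d →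
    zlevel G k ≤ bound d k := by
  induction d with
  | zero =>
      intro k G hG
      rcases Nat.eq_zero_or_pos k with rfl | hk
      · rw [bound_zero_right]; exact zlevel_zero_le_one G
      · rw [zlevel_eq_zero_of_const (apply_eq_of_mem_lowDeg_zero hG) hk]
        exact bound_nonneg 0 k
  | succ d' ih =>
      intro k
      induction k using Nat.strong_induction_on with
      | _ k ihk =>
        intro G hG
        rcases Nat.eq_zero_or_pos k with rfl | hk
        · rw [bound_zero_right]; exact zlevel_zero_le_one G
        have hk0 : (0 : ℝ) < k := by exact_mod_cast hk
        -- Claim 6.4: the disjoint pairs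
        have hdisj : ∑ S ∈ univ.powersetCard k, ∑ T ∈ univ.powersetCard k,
            (if (S ∩ T).card = 0 then |zcoef G S| * |zcoef G T| else 0) ≤
              ((2 * k).choose k : ℝ) * bound d' (2 * k) := by
          simp_rw [card_eq_zero, ← disjoint_iff_inter_eq_empty]
          exact claim64 (fun H hH => ih (2 * k) H hH) hG
        -- Claim 6.5: pairs meeting in `ℓ + 1` points
        have hrest : ∀ ℓ ∈ range k, ∑ S ∈ univ.powersetCard k, ∑ T ∈ univ.powersetCard k,
            (if (S ∩ T).card = ℓ + 1 then |zcoef G S| * |zcoef G T| else 0) ≤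
              zlevel G k * ((k.choose (ℓ + 1) : ℝ) * bound (d' + 1) (k - (ℓ + 1))) := by
          intro ℓ hℓ
          have hℓk : ℓ + 1 ≤ k := mem_range.1 hℓ
          have h := claim65 hℓk (fun H hH => ihk (k - (ℓ + 1)) (by omega) H hH) hG
          calc _ ≤ _ := h
            _ = _ := by ring
        -- Lemma 6.2
        have h62 : zlevel G k ^ 2 ≤ ((2 * k).choose k : ℝ) * bound d' (2 * k) +
            zlevel G k * ∑ ℓ ∈ range k, (k.choose (ℓ + 1) : ℝ) * bound (d' + 1) (k - (ℓ + 1)) := by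
          rw [zlevel_sq_eq, sum_range_succ', add_comm, mul_sum]
          exact add_le_add hdisj (sum_le_sum hrest)
        -- Theorem 6.1 from Lemma 6.2
        have hM : 0 < bound (d' + 1) k := by unfold bound; positivity
        refine le_of_sq_le hM (mul_nonneg (Nat.cast_nonneg _) (bound_nonneg _ _)) (zlevel_nonneg G k)
          h62 ?_
        calc ((2 * k).choose k : ℝ) * bound d' (2 * k) / bound (d' + 1) k +
              ∑ ℓ ∈ range k, (k.choose (ℓ + 1) : ℝ) * bound (d' + 1) (k - (ℓ + 1))
            ≤ (2 * (k : ℝ) * 2 ^ (3 * d')) ^ k +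
              ((1 + ((k - 1 : ℕ) : ℝ) * 2 ^ (3 * (d' + 1))) ^ k -
                (((k - 1 : ℕ) : ℝ) * 2 ^ (3 * (d' + 1))) ^ k) :=
              add_le_add (choose_mul_bound_div_le d' k hk) (sum_choose_mul_bound_le (d' + 1) k)
          _ ≤ bound (d' + 1) k := numeric_ineq d' k hk

end CHHL2018

/-- **Chattopadhyay–Hatami–Hosseini–Lovett, Theorem 6.1** (discharge of the named fact
`CHHL2018_fourierL1Level_le`): for an `𝔽₂`-polynomial `p` of total degree `≤ d`, `f = (-1)^p`
and every `k ≥ 1`, `∑_{|S|=k} |f̂(S)| ≤ (k · 2^{3d})^k`. The printed proof (ToC 15 (2019)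
art. 10, §6: Lemma 6.2 from Claims 6.3–6.5, then induction on `d` and `k`) is followed, with the
degree hypothesis carried as "all `(d+1)`-fold derivatives vanish" (`CHHL2018.lowDeg`) and the
base case taken at `d = 0`. [cite: ChattopadhyayEtAl2019, Thm. 6.1] -/
theorem CHHL2018_fourierL1Level_le_holds : CHHL2018_fourierL1Level_le := by
  intro m d k p hp _hk
  rw [CHHL2018.fourierL1Level_eq_zlevel]
  exact CHHL2018.zlevel_le_bound d k _ (CHHL2018.eval_mem_lowDeg p hp)

end Literature.Computability.QuantumComplexity

end
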